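import Summits.NavierStokesRegularity.NavierStokesRegularity.Theorems.FilamentSkeletonRssCoreLinearInvertibilityArnoldModeOne1DKernel

/-!
# Tools for stub `stub_arnoldModeOne1D` (crux `CoreLinearInvertibility`,
# stmt-NavierStokesRegularity-17973, route `FilamentSkeletonRss`, line `Sketch`) — part B: the functionals

For a continuous Gaussian-class `f` on `[0, ∞)` put `A_f(r) = ∫₀ʳ s² f`, `B_f(r) = ∫ᵣ^∞ f` (these are
`⟨Φ s 1_{(0,r]}, f⟩` and `⟨Φ s⁻¹ 1_{(r,∞)}, f⟩` in `L²(Φ⁻¹ s ds)`, `Φ = kerWeight`). This file: an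
integration-by-parts frame on `(0, ∞)` with vanishing boundary values; derivatives, continuity and
the bounds `|A_f| ≤ K r³`, `|A_f| ≤ ∫ s²|f|`, `|B_f| ≤ ∫|f|`, `|B_f| ≤ K_B e^{−r²/16}`; the
integrability of `A_f²/r³` and `r B_f²` on `(0, ∞)`. Folklore calculus; no definitions (statements are
spelled out).
-/

set_option linter.dupNamespace false

noncomputable section

namespace Summit.NavierStokesRegularity.NavierStokesRegularity.Theorems

open Set Function Filter MeasureTheory Topology
open Literature.Analysis.FluidPDE

/-! ### Integration by parts on `(0, ∞)` with vanishing boundary values -/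

/-- **FTC on `(0, ∞)` with zero boundary values**: if `Ψ' = ψ` on `(0,∞)`, `ψ ∈ L¹(0,∞)` and
`Ψ → 0` at `0⁺` and at `+∞`, then `∫₀^∞ ψ = 0`. [folklore] -/
theorem am1_integral_Ioi_eq_zero_of_hasDerivAt {Ψ ψ : ℝ → ℝ}
    (hderiv : ∀ r, 0 < r → HasDerivAt Ψ (ψ r) r) (hint : IntegrableOn ψ (Ioi 0))
    (h0 : Tendsto Ψ (𝓝[>] 0) (𝓝 0)) (hinf : Tendsto Ψ atTop (𝓝 0)) :
    ∫ r in Ioi (0 : ℝ), ψ r = 0 := by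
  set Ψ₀ : ℝ → ℝ := fun r => if 0 < r then Ψ r else 0 with hΨ₀
  have heq : ∀ r : ℝ, 0 < r → Ψ₀ r = Ψ r := fun r hr => if_pos hr
  have hderiv₀ : ∀ r ∈ Ioi (0 : ℝ), HasDerivAt Ψ₀ (ψ r) r := by
    intro r hr
    refine (hderiv r hr).congr_of_eventuallyEq ?_
    filter_upwards [Ioi_mem_nhds hr] with x hx using heq x hx
  have hcont : ContinuousWithinAt Ψ₀ (Ici 0) 0 := by
    rw [← continuousWithinAt_Ioi_iff_Ici, ContinuousWithinAt]
    have h00 : Ψ₀ 0 = 0 := if_neg (lt_irrefl 0)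
    rw [h00]
    exact h0.congr' (by filter_upwards [self_mem_nhdsWithin] with x hx using (heq x hx).symm)
  have hinf₀ : Tendsto Ψ₀ atTop (𝓝 0) :=
    hinf.congr' (by filter_upwards [Ioi_mem_atTop 0] with x hx using (heq x hx).symm)
  rw [integral_Ioi_of_hasDerivAt_of_tendsto hcont hderiv₀ hint hinf₀]
  simp [hΨ₀]

/-- A squeeze at `0⁺`: if `|Ψ r| ≤ b r` on `(0, δ)` hmm — on `(0, ∞)` — for a continuous `b` with
`b 0 = 0`, then `Ψ → 0` at `0⁺`. [folklore] -/
theorem am1_tendsto_zero_nhdsGT {Ψ b : ℝ → ℝ} (hb : Continuous b) (hb0 : b 0 = 0)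
    (hle : ∀ r, 0 < r → |Ψ r| ≤ b r) : Tendsto Ψ (𝓝[>] 0) (𝓝 0) := by
  have hbt : Tendsto b (𝓝[>] 0) (𝓝 0) := by
    have := hb.tendsto 0
    rw [hb0] at this
    exact tendsto_nhdsWithin_of_tendsto_nhds this
  refine squeeze_zero_norm' ?_ hbt
  filter_upwards [self_mem_nhdsWithin] with r hr
  rw [Real.norm_eq_abs]
  exact hle r hr

/-! ### The functionals `A_f(r) = ∫₀ʳ s² f`, `B_f(r) = ∫ᵣ^∞ f` -/

/-- `A_f' = r² f` for continuous `f`. [folklore] -/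
theorem am1_hasDerivAt_A {f : ℝ → ℝ} (hf : Continuous f) (r : ℝ) :
    HasDerivAt (fun x : ℝ => ∫ s in (0 : ℝ)..x, s ^ 2 * f s) (r ^ 2 * f r) r := by
  have hc : Continuous fun s : ℝ => s ^ 2 * f s := (continuous_pow 2).mul hf
  exact intervalIntegral.integral_hasDerivAt_right (hc.intervalIntegrable _ _)
    (hc.stronglyMeasurableAtFilter _ _) hc.continuousAt

/-- `∫ᵣ^∞ f = ∫₀^∞ f − ∫₀ʳ f` for `r ≥ 0` and `f ∈ L¹(0, ∞)`. [folklore] -/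
theorem am1_integral_Ioi_eq_sub {f : ℝ → ℝ} (hfi : IntegrableOn f (Ioi 0)) {r : ℝ} (hr : 0 ≤ r) :
    ∫ s in Ioi r, f s = (∫ s in Ioi (0 : ℝ), f s) - ∫ s in (0 : ℝ)..r, f s := by
  rw [← Ioc_union_Ioi_eq_Ioi hr, setIntegral_union (Ioc_disjoint_Ioi le_rfl) measurableSet_Ioi
    (hfi.mono_set Ioc_subset_Ioi_self) (hfi.mono_set (Ioi_subset_Ioi hr)),
    intervalIntegral.integral_of_le hr]
  ring

/-- `B_f' = −f` on `(0, ∞)` for continuous `f ∈ L¹(0, ∞)`. [folklore] -/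
theorem am1_hasDerivAt_B {f : ℝ → ℝ} (hf : Continuous f) (hfi : IntegrableOn f (Ioi 0)) {r : ℝ}
    (hr : 0 < r) : HasDerivAt (fun x : ℝ => ∫ s in Ioi x, f s) (-f r) r := by
  have h1 : HasDerivAt (fun x : ℝ => (∫ s in Ioi (0 : ℝ), f s) - ∫ s in (0 : ℝ)..x, f s) (-f r) r :=
    (intervalIntegral.integral_hasDerivAt_right (hf.intervalIntegrable _ _)
      (hf.stronglyMeasurableAtFilter _ _) hf.continuousAt).const_sub _
  refine h1.congr_of_eventuallyEq ?_
  filter_upwards [Ioi_mem_nhds hr] with x hx using am1_integral_Ioi_eq_sub hfi (le_of_lt hx)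

/-- `B_f` is continuous on `[0, ∞)`. [folklore] -/
theorem am1_continuousOn_B {f : ℝ → ℝ} (hf : Continuous f) (hfi : IntegrableOn f (Ioi 0)) :
    ContinuousOn (fun x : ℝ => ∫ s in Ioi x, f s) (Ici 0) := by
  have hc : Continuous fun x : ℝ => (∫ s in Ioi (0 : ℝ), f s) - ∫ s in (0 : ℝ)..x, f s :=
    continuous_const.sub (intervalIntegral.continuous_primitive (fun _ _ => hf.intervalIntegrable _ _) 0)
  exact hc.continuousOn.congr fun x hx => am1_integral_Ioi_eq_sub hfi hx

/-- The constants of a Gaussian-class `f`: one `K ≥ 0` with `|f| ≤ K e^{−r²/8}` and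
`r²|f| ≤ K e^{−r²/8}` on `[0, ∞)`. [folklore] -/
theorem am1_gc_consts {f : ℝ → ℝ} {C : ℝ} {N : ℕ}
    (hb : ∀ r, 0 ≤ r → |f r| ≤ C * (1 + r) ^ N * Real.exp (-(r ^ 2 / 4))) :
    ∃ K : ℝ, 0 ≤ K ∧ (∀ r, 0 ≤ r → |f r| ≤ K * Real.exp (-(r ^ 2 / 8))) ∧
      (∀ r, 0 ≤ r → r ^ 2 * |f r| ≤ K * Real.exp (-(r ^ 2 / 8))) ∧ (∀ r, 0 ≤ r → |f r| ≤ K) := by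
  refine ⟨|C| * Real.exp (2 * ((N + 2 : ℕ) : ℝ) ^ 2), by positivity, fun r hr => ?_, fun r hr =>
    am1_pow_mul_abs_le hb 2 hr, fun r hr => ?_⟩
  · have h := am1_pow_mul_abs_le hb 0 hr
    rw [pow_zero, one_mul] at h
    refine h.trans ?_
    gcongr
    simp
  · have h := am1_pow_mul_abs_le hb 0 hr
    rw [pow_zero, one_mul] at h
    refine h.trans ?_
    have h1 : Real.exp (-(r ^ 2 / 8)) ≤ 1 := Real.exp_le_one_iff.2 (by nlinarith)
    calc |C| * Real.exp (2 * ((N + 0 : ℕ) : ℝ) ^ 2) * Real.exp (-(r ^ 2 / 8))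
        ≤ |C| * Real.exp (2 * ((N + 2 : ℕ) : ℝ) ^ 2) * 1 := by
          gcongr
          simp
      _ = _ := mul_one _

/-- `|A_f(r)| ≤ K r³` on `[0, ∞)` when `|f| ≤ K` there. [folklore] -/
theorem am1_abs_A_le_cube {f : ℝ → ℝ} {K : ℝ} (hK : ∀ r, 0 ≤ r → |f r| ≤ K) {r : ℝ} (hr : 0 ≤ r) :
    |∫ s in (0 : ℝ)..r, s ^ 2 * f s| ≤ K * r ^ 3 := by
  have h : ∀ x ∈ Set.uIoc (0 : ℝ) r, ‖x ^ 2 * f x‖ ≤ r ^ 2 * K := by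
    intro x hx
    rw [uIoc_of_le hr] at hx
    rw [Real.norm_eq_abs, abs_mul, abs_of_nonneg (sq_nonneg x)]
    have hx2 : x ^ 2 ≤ r ^ 2 := pow_le_pow_left₀ hx.1.le hx.2 2
    exact mul_le_mul hx2 (hK x hx.1.le) (abs_nonneg _) (sq_nonneg r)
  have := intervalIntegral.norm_integral_le_of_norm_le_const h
  rw [Real.norm_eq_abs, sub_zero, abs_of_nonneg hr] at this
  calc |∫ s in (0 : ℝ)..r, s ^ 2 * f s| ≤ r ^ 2 * K * r := this
    _ = K * r ^ 3 := by ring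

/-- `|A_f(r)| ≤ ∫₀^∞ s²|f|` on `[0, ∞)`. [folklore] -/
theorem am1_abs_A_le_integral {f : ℝ → ℝ} (hf : Continuous f) {C : ℝ} {N : ℕ}
    (hb : ∀ r, 0 ≤ r → |f r| ≤ C * (1 + r) ^ N * Real.exp (-(r ^ 2 / 4))) {r : ℝ} (hr : 0 ≤ r) :
    |∫ s in (0 : ℝ)..r, s ^ 2 * f s| ≤ ∫ s in Ioi (0 : ℝ), s ^ 2 * |f s| := by
  have hi := am1_integrableOn_pow_mul_abs hf hb 2
  calc |∫ s in (0 : ℝ)..r, s ^ 2 * f s| ≤ ∫ s in (0 : ℝ)..r, |s ^ 2 * f s| :=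
        intervalIntegral.abs_integral_le_integral_abs hr
    _ = ∫ s in Ioc 0 r, s ^ 2 * |f s| := by
        rw [intervalIntegral.integral_of_le hr]
        refine setIntegral_congr_fun measurableSet_Ioc fun s hs => ?_
        rw [abs_mul, abs_of_nonneg (sq_nonneg s)]
    _ ≤ ∫ s in Ioi (0 : ℝ), s ^ 2 * |f s| :=
        setIntegral_mono_set hi (Eventually.of_forall fun s => mul_nonneg (sq_nonneg s) (abs_nonneg _))
          (Eventually.of_forall Ioc_subset_Ioi_self)

/-- `|B_f(r)| ≤ ∫₀^∞ |f|` on `[0, ∞)`. [folklore] -/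
theorem am1_abs_B_le_integral {f : ℝ → ℝ} (hfi : IntegrableOn f (Ioi 0)) {r : ℝ} (hr : 0 ≤ r) :
    |∫ s in Ioi r, f s| ≤ ∫ s in Ioi (0 : ℝ), |f s| := by
  calc |∫ s in Ioi r, f s| ≤ ∫ s in Ioi r, |f s| := abs_integral_le_integral_abs
    _ ≤ ∫ s in Ioi (0 : ℝ), |f s| :=
        setIntegral_mono_set hfi.abs (Eventually.of_forall fun s => abs_nonneg _)
          (Eventually.of_forall (Ioi_subset_Ioi hr))

/-- Gaussian decay of the tail functional: `|B_f(r)| ≤ K_B e^{−r²/16}` on `[0, ∞)` with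
`K_B = K ∫₀^∞ e^{−s²/16} ds` (`e^{−s²/8} ≤ e^{−r²/16} e^{−s²/16}` for `s ≥ r`). [folklore] -/
theorem am1_abs_B_le_exp {f : ℝ → ℝ} (hf : Continuous f) {K : ℝ} (hK0 : 0 ≤ K)
    (hK : ∀ r, 0 ≤ r → |f r| ≤ K * Real.exp (-(r ^ 2 / 8))) :
    ∃ KB : ℝ, 0 ≤ KB ∧ ∀ r, 0 ≤ r → |∫ s in Ioi r, f s| ≤ KB * Real.exp (-(r ^ 2 / 16)) := by
  have h16 : (0 : ℝ) < 1 / 16 := by norm_num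
  have hgi : IntegrableOn (fun s : ℝ => Real.exp (-(s ^ 2 / 16))) (Ioi 0) := by
    refine (integrable_exp_neg_mul_sq h16).integrableOn.congr_fun (fun s _ => ?_) measurableSet_Ioi
    show Real.exp _ = Real.exp _
    congr 1; ring
  set J : ℝ := ∫ s in Ioi (0 : ℝ), Real.exp (-(s ^ 2 / 16)) with hJ
  have hJ0 : 0 ≤ J := setIntegral_nonneg measurableSet_Ioi fun s _ => (Real.exp_pos _).le
  refine ⟨K * J, mul_nonneg hK0 hJ0, fun r hr => ?_⟩
  have hfi : IntegrableOn f (Ioi r) := by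
    refine Integrable.mono' ((hgi.mono_set (Ioi_subset_Ioi hr)).const_mul K) hf.aestronglyMeasurable ?_
    refine (ae_restrict_iff' measurableSet_Ioi).2 (Eventually.of_forall fun s hs => ?_)
    have hs0 : 0 ≤ s := hr.trans (le_of_lt hs)
    refine (hK s hs0).trans (mul_le_mul_of_nonneg_left (Real.exp_le_exp.2 ?_) hK0)
    nlinarith [sq_nonneg s]
  have hpt : ∀ s ∈ Ioi r, |f s| ≤ K * Real.exp (-(r ^ 2 / 16)) * Real.exp (-(s ^ 2 / 16)) := by
    intro s hs
    have hs0 : 0 ≤ s := hr.trans (le_of_lt hs)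
    have hrs : r ^ 2 ≤ s ^ 2 := pow_le_pow_left₀ hr (le_of_lt hs) 2
    calc |f s| ≤ K * Real.exp (-(s ^ 2 / 8)) := hK s hs0
      _ ≤ K * (Real.exp (-(r ^ 2 / 16)) * Real.exp (-(s ^ 2 / 16))) := by
          refine mul_le_mul_of_nonneg_left ?_ hK0
          rw [← Real.exp_add]
          exact Real.exp_le_exp.2 (by nlinarith)
      _ = _ := by ring
  calc |∫ s in Ioi r, f s| ≤ ∫ s in Ioi r, |f s| := abs_integral_le_integral_abs
    _ ≤ ∫ s in Ioi r, K * Real.exp (-(r ^ 2 / 16)) * Real.exp (-(s ^ 2 / 16)) :=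
        setIntegral_mono_on hfi.abs ((hgi.mono_set (Ioi_subset_Ioi hr)).const_mul _)
          measurableSet_Ioi hpt
    _ = K * Real.exp (-(r ^ 2 / 16)) * ∫ s in Ioi r, Real.exp (-(s ^ 2 / 16)) :=
        MeasureTheory.integral_const_mul _ _
    _ ≤ K * Real.exp (-(r ^ 2 / 16)) * J := by
        refine mul_le_mul_of_nonneg_left ?_ (by positivity)
        exact setIntegral_mono_set hgi (Eventually.of_forall fun s => (Real.exp_pos _).le)
          (Eventually.of_forall (Ioi_subset_Ioi hr))
    _ = K * J * Real.exp (-(r ^ 2 / 16)) := by ring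

/-- Integrability on `(0, ∞)` from a bound on `(0, 1]` and an integrable majorant on `(1, ∞)`,
for a function continuous on `(0, ∞)`. [folklore] -/
theorem am1_integrableOn_of_bounds {φ ψ : ℝ → ℝ} (hφ : ContinuousOn φ (Ioi 0)) {M : ℝ}
    (h1 : ∀ r, 0 < r → r ≤ 1 → |φ r| ≤ M) (hψ : IntegrableOn ψ (Ioi 1))
    (h2 : ∀ r, 1 < r → |φ r| ≤ ψ r) : IntegrableOn φ (Ioi 0) := by
  rw [← Ioc_union_Ioi_eq_Ioi zero_le_one]
  refine IntegrableOn.union ?_ ?_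
  · refine Integrable.mono' (integrableOn_const (C := M) (by simp))
      ((hφ.mono Ioc_subset_Ioi_self).aestronglyMeasurable measurableSet_Ioc) ?_
    exact (ae_restrict_iff' measurableSet_Ioc).2 (Eventually.of_forall fun r hr => h1 r hr.1 hr.2)
  · refine Integrable.mono' hψ ((hφ.mono (Ioi_subset_Ioi zero_le_one)).aestronglyMeasurable
      measurableSet_Ioi) ?_
    exact (ae_restrict_iff' measurableSet_Ioi).2 (Eventually.of_forall fun r hr => h2 r hr)

/-- `A_f²/r³` is integrable on `(0, ∞)` (`≤ K²r³` on `(0,1]`, `≤ I₂²/r³` on `(1,∞)`). [folklore] -/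
theorem am1_integrableOn_A_sq_div {f : ℝ → ℝ} (hf : Continuous f) {C : ℝ} {N : ℕ}
    (hb : ∀ r, 0 ≤ r → |f r| ≤ C * (1 + r) ^ N * Real.exp (-(r ^ 2 / 4))) :
    IntegrableOn (fun r : ℝ => (∫ s in (0 : ℝ)..r, s ^ 2 * f s) ^ 2 / r ^ 3) (Ioi 0) := by
  obtain ⟨K, hK0, -, -, hK⟩ := am1_gc_consts hb
  set I₂ : ℝ := ∫ s in Ioi (0 : ℝ), s ^ 2 * |f s| with hI₂
  have hAc : Continuous fun r : ℝ => ∫ s in (0 : ℝ)..r, s ^ 2 * f s :=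
    continuous_iff_continuousAt.2 fun r => (am1_hasDerivAt_A hf r).continuousAt
  refine am1_integrableOn_of_bounds (M := K ^ 2) (ψ := fun r => I₂ ^ 2 / 4 * (4 / r ^ 3))
    (((hAc.pow 2).continuousOn).div ((continuous_pow 3).continuousOn)
      fun r hr => pow_ne_zero 3 (ne_of_gt hr)) (fun r hr0 hr1 => ?_)
    ((integral_Ioi_four_div_cube zero_lt_one).2.const_mul (I₂ ^ 2 / 4)) (fun r hr => ?_)
  · have hA := am1_abs_A_le_cube hK hr0.le
    rw [abs_div, abs_of_pos (pow_pos hr0 3), div_le_iff₀ (pow_pos hr0 3), abs_of_nonneg (sq_nonneg _)]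
    calc (∫ s in (0 : ℝ)..r, s ^ 2 * f s) ^ 2 = |∫ s in (0 : ℝ)..r, s ^ 2 * f s| ^ 2 := (sq_abs _).symm
      _ ≤ (K * r ^ 3) ^ 2 := pow_le_pow_left₀ (abs_nonneg _) hA 2
      _ = K ^ 2 * r ^ 3 * r ^ 3 := by ring
      _ ≤ K ^ 2 * 1 * r ^ 3 := by
          gcongr
          exact pow_le_one₀ hr0.le hr1
      _ = K ^ 2 * r ^ 3 := by ring
  · have hr0 : 0 < r := zero_lt_one.trans hr
    have hA := am1_abs_A_le_integral hf hb hr0.le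
    rw [abs_div, abs_of_pos (pow_pos hr0 3), abs_of_nonneg (sq_nonneg _)]
    have hI0 : 0 ≤ I₂ := setIntegral_nonneg measurableSet_Ioi fun s _ => mul_nonneg (sq_nonneg s) (abs_nonneg _)
    calc (∫ s in (0 : ℝ)..r, s ^ 2 * f s) ^ 2 / r ^ 3 = |∫ s in (0 : ℝ)..r, s ^ 2 * f s| ^ 2 / r ^ 3 := by
          rw [sq_abs]
      _ ≤ I₂ ^ 2 / r ^ 3 := by
          gcongr
      _ = I₂ ^ 2 / 4 * (4 / r ^ 3) := by field_simp

/-- `r B_f(r)²` is integrable on `(0, ∞)` (`≤ K_B² r e^{−r²/8}`). [folklore] -/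
theorem am1_integrableOn_mul_B_sq {f : ℝ → ℝ} (hf : Continuous f) {C : ℝ} {N : ℕ}
    (hb : ∀ r, 0 ≤ r → |f r| ≤ C * (1 + r) ^ N * Real.exp (-(r ^ 2 / 4))) :
    IntegrableOn (fun r : ℝ => r * (∫ s in Ioi r, f s) ^ 2) (Ioi 0) := by
  obtain ⟨K, hK0, hK8, -, -⟩ := am1_gc_consts hb
  obtain ⟨KB, hKB0, hKB⟩ := am1_abs_B_le_exp hf hK0 hK8
  have hfi : IntegrableOn f (Ioi 0) :=
    (am1_integrableOn_pow_mul hf hb 0).congr_fun (fun r _ => by simp) measurableSet_Ioi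
  have hBc := am1_continuousOn_B hf hfi
  refine Integrable.mono' (am1_integrableOn_exp_neg_sq.2.const_mul (KB ^ 2)) ?_ ?_
  · exact ContinuousOn.aestronglyMeasurable
      (continuousOn_id.mul ((hBc.mono Ioi_subset_Ici_self).pow 2)) measurableSet_Ioi
  refine (ae_restrict_iff' measurableSet_Ioi).2 (Eventually.of_forall fun r hr => ?_)
  have hr0 : 0 ≤ r := le_of_lt hr
  rw [Real.norm_eq_abs, abs_mul, abs_of_nonneg hr0, abs_of_nonneg (sq_nonneg _)]
  have hB := hKB r hr0
  have he : Real.exp (-(r ^ 2 / 16)) ^ 2 = Real.exp (-(r ^ 2 / 8)) := by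
    rw [← Real.exp_nat_mul]; congr 1; ring
  calc r * (∫ s in Ioi r, f s) ^ 2 = r * |∫ s in Ioi r, f s| ^ 2 := by rw [sq_abs]
    _ ≤ r * (KB * Real.exp (-(r ^ 2 / 16))) ^ 2 := by
        gcongr
    _ = KB ^ 2 * (r * Real.exp (-(r ^ 2 / 8))) := by rw [mul_pow, he]; ring

/-! ### The registered tools stub -/

/-- **Registered tools stub `stub_arnoldModeOne1DToolsB`** (helpers for `stub_arnoldModeOne1D`, line
`Sketch` of crux `CoreLinearInvertibility`, stmt-NavierStokesRegularity-17973): FTC on `(0,∞)` with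
vanishing boundary values, and the integrability of `A_f²/r³`, `r B_f²` for a continuous Gaussian-class
`f`. [folklore] -/
theorem stub_arnoldModeOne1DToolsB :
    (∀ (Ψ ψ : ℝ → ℝ), (∀ r : ℝ, 0 < r → HasDerivAt Ψ (ψ r) r) → IntegrableOn ψ (Set.Ioi 0) →
      Filter.Tendsto Ψ (nhdsWithin 0 (Set.Ioi 0)) (nhds 0) → Filter.Tendsto Ψ Filter.atTop (nhds 0) →
      ∫ r in Set.Ioi (0 : ℝ), ψ r = 0) ∧
    (∀ (f : ℝ → ℝ) (C : ℝ) (N : ℕ), Continuous f →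
      (∀ r : ℝ, 0 ≤ r → |f r| ≤ C * (1 + r) ^ N * Real.exp (-(r ^ 2 / 4))) →
      IntegrableOn (fun r : ℝ => (∫ s in (0 : ℝ)..r, s ^ 2 * f s) ^ 2 / r ^ 3) (Set.Ioi 0) ∧
        IntegrableOn (fun r : ℝ => r * (∫ s in Set.Ioi r, f s) ^ 2) (Set.Ioi 0)) :=
  ⟨fun _ _ hd hi h0 hinf => am1_integral_Ioi_eq_zero_of_hasDerivAt hd hi h0 hinf,
    fun _ _ _ hf hb => ⟨am1_integrableOn_A_sq_div hf hb, am1_integrableOn_mul_B_sq hf hb⟩⟩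

end Summit.NavierStokesRegularity.NavierStokesRegularity.Theorems
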